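import Summits.ResolutionOfSingularities.ResolutionOfSingularities.Theorems.MaxContactCutTauChainCut
import Summits.ResolutionOfSingularities.ResolutionOfSingularities.Theorems.RestrictCutPort2
import HarnessLib

/-!
# MaxContactCutPortDischarge — decomp-res RIDER «PortDischarge» (lens-4 g34, critic row 194a (MAP (M-27723) +1)),
tree file 3/4 of the rider

Content VERBATIM from the decomp-res lens-4 g34 RIDER `HOME/decomp-res-lens-4/g34/FactorContactPortDischarge.lean`
(pin 9c49c6fa); HOME = run/shared/lean/pub/decomp-res; critic row 194a (MAP (M-27723) +1); landing orders INBOX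
:1147/:1163 — provenance, critic text and the rider header in full in the first file, `RestrictCutPort`.  Namespace
`…Theorems.HugValuationCut`.

## This file

§114a (g34 rider · NEW) ITEM 27723 BY NAME in the Theses cone (`section PortThesesCone`): `fcFactorContactPortAll_holds : MaxContactCut.FCFactorContactPortAll` — the registered port aside of route MaxContactCut (item stmt-ResolutionOfSingularities-27723) DISCHARGED IN KERNEL (`:= factorContactPortAll_holds` of `RestrictCutPort2`).  Proposed `--kind proof --workitem stmt-ResolutionOfSingularities-27723` (proof of item).  Imports `RestrictCutPort2` + `MaxContactCutTauChainCut` (⊇ `Theses.MaxContactCut`, as the rider file does); 0 sorry.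

[WRITER NOTE (decomp-res writer g12): file split only (tree files ≤ 400 lines); namespace, sections, section
variables / universes / opens and every declaration exactly as in the rider (its §105 carry and file-level
dupNamespace-linter line dropped; the `open …Theses` line lives only in the Theses-cone files `MaxContactCutPortDischarge*`).]

(Sources: Hironaka1964 Ch. III; Giraud1975; Kollar2007 3.58–3.60; CossartJannsenSaito2020 Thm. 6.40, Ch. 8;
Hauser2010Kangaroo; HauserPerlega2019 §2; CossartPiltant2008 §2; deJong1996; Hironaka2005; EGAIV2 §5 (dimension),
EGAIV4 §16, §21; Matsumura1987 §14–§15 (dimension of quotients), §20, §28; Liu2002 §8.2 (blow-ups: integrality,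
birationality, dimension); StacksProject 02ND / 0804 / 0BIQ / 031I / 0AFT.)
-/

noncomputable section

open CategoryTheory AlgebraicGeometry IsLocalRing TopologicalSpace
open Literature.AlgebraicGeometry.Resolution
open Literature.AlgebraicGeometry.Resolution.Hironaka2005 (le_idealOrder_of_mul_le le_idealOrder_of_mul_le')
open Summit.ResolutionOfSingularities.ResolutionOfSingularities.Theses
open Summit.ResolutionOfSingularities.ResolutionOfSingularities.Theorems
open WeakOrderReduction ForcedTowerClasses DivergentTowerClasses MonomialTowerClasses
open HugDimensionClasses HugDimensionKernels SurfaceShadowClasses SurfaceShadowKernels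
open NearPointCut (SingularClass)
open AbsoluteContactClasses (IsAbsContactAt)
open Scheme.IdealSheafData (vanishingIdeal)
open scoped BigOperators nonZeroDivisors

namespace Summit.ResolutionOfSingularities.ResolutionOfSingularities.Theorems.HugValuationCut

section PortThesesCone

/-! ## ══ FILE 2/2 `Theorems/MaxContactCutPortDischarge.lean` (§114; Theses cone, imports FILE 1 + `Theses.MaxContactCut`) ══ -/

/-! ## §114 (g34 rider · NEW) ITEMS 27723 AND 27721 BY NAME (Theses cone) -/

/-- **ITEM 27723 (`MaxContactCut.FCFactorContactPortAll`, registered port aside) DISCHARGED IN KERNEL, BY NAME.** [folklore] -/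
theorem fcFactorContactPortAll_holds : MaxContactCut.FCFactorContactPortAll := factorContactPortAll_holds

end PortThesesCone

end Summit.ResolutionOfSingularities.ResolutionOfSingularities.Theorems.HugValuationCut
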